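import Mathlib
import Summits.Ventures.Crystal3D.Theorems.StickyWulffConstantStackingLiminfMollifiedUpperOfSkew
import Summits.Ventures.Crystal3D.Theorems.StickyWulffConstantStackingLiminfSkewBoundIntegral
import HarnessLib

/-!
# Stub (B) `stub_mollifiedUpper` of line LayerChain v4 (crux `StackingLiminf`, stmt-Ventures-19145), BY NAME

Cell `crystal3d-full`, venture `Summits/Ventures/Crystal3D`.  The registered stub (B) of the skeleton
`HOME/cf-p1/route/lines/LayerChainV4.lean`: the DISCRETE → CONTINUUM mollification inequality with the exact
constant `√2`,
`modTV (smooth x K L) (window σ K) ≤ √2·(6N − numContacts x) + C₀ (N/K² + K·(6N − numContacts x)/L)`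
for every Hägg word, every injective configuration in its Barlow stacking and all `1 ≤ K ≤ L`.
Proof = the kernel-checked reduction `mollifiedUpper_of_skewBound` (wulff-p2 g4, p522162: S1 sharp triangle
inequality p512839 + S2 Taylor p517524 + S3 two-phase pairing p515111/p520614/p520888 + lateral calculus
p516323) applied to the SKEW BOUND `‖E‖₁ ≤ C (K·D + N/K)` (eng g6: lateral quadrature p523116, occupied–vacant
overlap p520608, pointwise skew `abs_skew_pointwise`, integrated ``PlateauHeight.skewBound`, p525218`).
WHAT THIS IS NOT: the crux (that is `…Theorems/StickyWulffConstantStackingLiminf.lean`); rung F-C1 not moved.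
-/

noncomputable section

namespace Summit.Ventures.Crystal3D.Theorems

open Summit.Ventures.Crystal3D.Cruxes.StackingLiminf.LayerChainV4 (MollifiedUpper)

/-- **Stub (B) of LayerChain v4, BY NAME**: the mollification inequality `MollifiedUpper`. -/
theorem stub_mollifiedUpper : MollifiedUpper :=
  mollifiedUpper_of_skewBound PlateauHeight.skewBound

end Summit.Ventures.Crystal3D.Theorems

end
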